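import Summits.CriticalPhenomena.PercolationContinuityZ3.Theorems.PercNearOneGluingAdditiveGluingFingerBridgeValues
import HarnessLib

/-! # Crux `PercNearOneGluing.AdditiveGluing` (stmt-CriticalPhenomena-4576) — pattern reliabilities of a GLUED two-relay finger block
# (seat (b) V⁺-form, depth prover `png-dp-vplus`)

Support file (`--supports stmt-CriticalPhenomena-4576`); no definitions, no named facts.  Companion of `…AdditiveGluingFingerBridgeValues.lean`
(un-glued patterns).  For `g = K/N` and a pattern `J` of the contact pairs to `w₁, w₂`: the reliability of `y ∉ N` under `pinW g F J` is the base
quantity `μ_q{y ↔ b in (ω ∖ pairs at N) ∪ Q}` with `Q = {s(w₁,w₂)}` iff both relays are touched (`real_openConn_pinW_glued`); the block's reach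
`⋃_v {v↔b}` has the reliability of any touched relay (`real_blockReach_pinW_glued`); and the two relays are interchangeable in the bridged base
event (`bridgeEvent_eq_of_swap`). [folklore; Grimmett 1999 §1.3–2.2; KozmaNitzan2024 §3.1, §4 p. 20]
-/

namespace Summit.CriticalPhenomena.PercolationContinuityZ3.Theorems

open MeasureTheory Set
open Literature.Probability.LatticeModels (prodBernoulli)
open Literature.Probability.Percolation (BondConfig openConn openGraph pinW localCylinder DeterminedBy determinedBy_iff)

noncomputable section
open Classical

section FingerBridgeGlued

open Literature.Probability.LatticeModels Literature.Probability.Percolation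

variable {n : ℕ}

section TwoRelaysGlued

variable (K : Sym2 (Fin n) → unitInterval) (N : Finset (Fin n)) (w₁ w₂ b : Fin n)

/-- **Glued pattern reliability.**  `g = K/N` (block glued), `J ⊆ F`; `both` = both relays touched by `J`.  For `y, b ∉ N`,
`μ_{pinW g F J}(y ↔ b) = μ_q{y ↔ b in (ω ∖ pairs at N) ∪ Q}` with `Q = {s(w₁,w₂)}` if both relays are touched and `Q = ∅` otherwise
(given as the hypothesis `hQ`). [folklore; KozmaNitzan2024 §3.1, §4 p. 20] -/
theorem real_openConn_pinW_glued (hw₁ : w₁ ∉ N) (hw₂ : w₂ ∉ N) (h12 : w₁ ≠ w₂)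
    (hcont : ∀ v ∈ N, ∀ z : Fin n, z ∉ N → z ≠ w₁ → z ≠ w₂ → K s(v, z) = 0)
    (J : Finset (Sym2 (Fin n))) (hJF : J ⊆ N.image (fun v => s(v, w₁)) ∪ N.image (fun v => s(v, w₂)))
    (Q : Set (Sym2 (Fin n)))
    (hQ : (((∃ v ∈ N, s(v, w₁) ∈ J) ∧ (∃ v ∈ N, s(v, w₂) ∈ J)) ∧ Q = {s(w₁, w₂)}) ∨
      (¬ ((∃ v ∈ N, s(v, w₁) ∈ J) ∧ (∃ v ∈ N, s(v, w₂) ∈ J)) ∧ Q = ∅))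
    {y : Fin n} (hy : y ∉ N) (hbN : b ∉ N) :
    (prodBernoulli (pinW (fun e' : Sym2 (Fin n) => if (∀ z ∈ e', z ∈ N) ∧ ¬ e'.IsDiag then 1 else K e')
        (↑(N.image (fun v => s(v, w₁)) ∪ N.image (fun v => s(v, w₂))) : Set (Sym2 (Fin n))) ↑J)).real (openConn y b) =
      (prodBernoulli (fun e : Sym2 (Fin n) => if (∃ z ∈ e, z ∈ N) then (0 : unitInterval) else K e)).real
        {ω : BondConfig (Fin n) | (openGraph (({e | e ∈ ω ∧ ∀ z ∈ e, z ∉ N} ∪ Q : Set (Sym2 (Fin n))) :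
          BondConfig (Fin n))).Reachable y b} := by
  set F : Finset (Sym2 (Fin n)) := N.image (fun v => s(v, w₁)) ∪ N.image (fun v => s(v, w₂)) with hFdef
  set g : Sym2 (Fin n) → unitInterval := fun e' => if (∀ z ∈ e', z ∈ N) ∧ ¬ e'.IsDiag then 1 else K e' with hg
  set I : Finset (Sym2 (Fin n)) := ((N ×ˢ N).filter (fun vv : Fin n × Fin n => vv.1 ≠ vv.2)).image
    (fun vv => s(vv.1, vv.2)) with hI
  have hJ : ∀ e ∈ J, ∃ v ∈ N, ∃ w ∈ ({w₁, w₂} : Finset (Fin n)), e = s(v, w) := by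
    intro e he
    rcases Finset.mem_union.1 (hJF he) with h | h
    · obtain ⟨v, hv, rfl⟩ := Finset.mem_image.1 h
      exact ⟨v, hv, w₁, by simp, rfl⟩
    · obtain ⟨v, hv, rfl⟩ := Finset.mem_image.1 h
      exact ⟨v, hv, w₂, by simp, rfl⟩
  have hIin : ∀ e ∈ I, (∀ z ∈ e, z ∈ N) ∧ ¬ e.IsDiag := by
    intro e he
    obtain ⟨⟨v, v'⟩, hvv, rfl⟩ := Finset.mem_image.1 he
    obtain ⟨hvv', hne⟩ := Finset.mem_filter.1 hvv
    obtain ⟨hv, hv'⟩ := Finset.mem_product.1 hvv'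
    refine ⟨fun z hz => ?_, fun h => hne (Sym2.mk_isDiag_iff.1 h)⟩
    rcases Sym2.mem_iff.1 hz with rfl | rfl
    · exact hv
    · exact hv'
  have hInotF : ∀ e ∈ I, e ∉ (↑F : Set (Sym2 (Fin n))) := by
    intro e he heF
    obtain ⟨hin, -⟩ := hIin e he
    rcases Finset.mem_union.1 (Finset.mem_coe.1 heF) with h | h
    · obtain ⟨v, -, rfl⟩ := Finset.mem_image.1 h
      exact hw₁ (hin w₁ (Sym2.mem_mk_right v w₁))
    · obtain ⟨v, -, rfl⟩ := Finset.mem_image.1 h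
      exact hw₂ (hin w₂ (Sym2.mem_mk_right v w₂))
  refine real_openConn_eq_of_blockPairs_nd _ _ N (J ∪ I) Q ?_ ?_ ?_ ?_ ?_ ?_ hy hbN
  · intro e he
    rcases Finset.mem_union.1 he with heJ | heI
    · exact pinW_apply_of_mem_of_mem g (Finset.mem_coe.2 (hJF heJ)) (Finset.mem_coe.2 heJ)
    · rw [pinW_apply_of_not_mem g _ (hInotF e heI)]
      show (if (∀ z ∈ e, z ∈ N) ∧ ¬ e.IsDiag then (1 : unitInterval) else K e) = 1
      rw [if_pos (hIin e heI)]
  · intro e heO hnd hz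
    by_cases heF : e ∈ F
    · exact pinW_apply_of_mem_of_not_mem g (Finset.mem_coe.2 heF)
        (fun h => heO (Finset.mem_union.2 (Or.inl (Finset.mem_coe.1 h))))
    · rw [pinW_apply_of_not_mem g _ (fun h => heF (Finset.mem_coe.1 h))]
      have hnotin : ¬ ((∀ z ∈ e, z ∈ N) ∧ ¬ e.IsDiag) := by
        rintro ⟨hin, -⟩
        apply heO (Finset.mem_union.2 (Or.inr ?_))
        induction e using Sym2.ind with
        | h x x' =>
          refine Finset.mem_image.2 ⟨(x, x'), Finset.mem_filter.2 ⟨Finset.mem_product.2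
            ⟨hin x (Sym2.mem_mk_left x x'), hin x' (Sym2.mem_mk_right x x')⟩, fun h => hnd (Sym2.mk_isDiag_iff.2 h)⟩, rfl⟩
      simp only [hg, hnotin, if_false]
      -- now `K e = 0`: the pair meets `N`, is not internal, is not a contact
      induction e using Sym2.ind with
      | h x x' =>
        have hne : x ≠ x' := fun h => hnd (Sym2.mk_isDiag_iff.2 h)
        have key : ∀ a c : Fin n, a ∈ N → c ∉ N → s(a, c) ∉ F → K s(a, c) = 0 := by
          intro a c ha hc hF
          have hc1 : c ≠ w₁ := by
            rintro rfl; exact hF (Finset.mem_union.2 (Or.inl (Finset.mem_image.2 ⟨a, ha, rfl⟩)))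
          have hc2 : c ≠ w₂ := by
            rintro rfl; exact hF (Finset.mem_union.2 (Or.inr (Finset.mem_image.2 ⟨a, ha, rfl⟩)))
          exact hcont a ha c hc hc1 hc2
        obtain ⟨z, hz, hzN⟩ := hz
        by_cases hx : x ∈ N <;> by_cases hx' : x' ∈ N
        · exact (hnotin ⟨fun z hz => by rcases Sym2.mem_iff.1 hz with rfl | rfl <;> assumption,
            fun h => hne (Sym2.mk_isDiag_iff.1 h)⟩).elim
        · exact key x x' hx hx' heF
        · rw [Sym2.eq_swap]; rw [Sym2.eq_swap] at heF; exact key x' x hx' hx heF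
        · rcases Sym2.mem_iff.1 hz with rfl | rfl
          · exact (hx hzN).elim
          · exact (hx' hzN).elim
  · intro e he z hz
    rcases hQ with ⟨-, rfl⟩ | ⟨-, rfl⟩
    · rw [Set.mem_singleton_iff.1 he] at hz
      rcases Sym2.mem_iff.1 hz with rfl | rfl
      · exact hw₁
      · exact hw₂
    · exact (Set.notMem_empty e he).elim
  · intro e he u hu u' hu'
    rcases hQ with ⟨⟨⟨v₁, hv₁, hv₁J⟩, ⟨v₂, hv₂, hv₂J⟩⟩, rfl⟩ | ⟨-, rfl⟩
    · rw [Set.mem_singleton_iff.1 he] at hu hu'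
      -- `w₁ – v₁ – v₂ – w₂` inside `J ∪ I`
      have h12' : (openGraph (↑(J ∪ I) : Set (Sym2 (Fin n)))).Reachable v₁ v₂ := by
        by_cases hvv : v₁ = v₂
        · rw [hvv]
        · refine ((openGraph_adj _ v₁ v₂).2 ⟨Finset.mem_coe.2 (Finset.mem_union.2 (Or.inr ?_)), hvv⟩).reachable
          exact Finset.mem_image.2 ⟨(v₁, v₂), Finset.mem_filter.2 ⟨Finset.mem_product.2 ⟨hv₁, hv₂⟩, hvv⟩, rfl⟩
      have hreach : ∀ x ∈ s(w₁, w₂), (openGraph (↑(J ∪ I) : Set (Sym2 (Fin n)))).Reachable v₁ x := by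
        intro x hx
        rcases Sym2.mem_iff.1 hx with rfl | rfl
        · exact ((openGraph_adj _ v₁ x).2 ⟨Finset.mem_coe.2 (Finset.mem_union.2 (Or.inl hv₁J)),
            fun h => hw₁ (h ▸ hv₁)⟩).reachable
        · exact h12'.trans ((openGraph_adj _ v₂ x).2 ⟨Finset.mem_coe.2 (Finset.mem_union.2 (Or.inl hv₂J)),
            fun h => hw₂ (h ▸ hv₂)⟩).reachable
      exact (hreach u hu).symm.trans (hreach u' hu')
    · exact (Set.notMem_empty e he).elim
  · intro u u' hu hu' h
    have hO : ∀ e ∈ (↑(J ∪ I) : Set (Sym2 (Fin n))),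
        (e ∈ J ∧ ∃ v ∈ N, ∃ w ∈ ({w₁, w₂} : Finset (Fin n)), e = s(v, w)) ∨ (∀ z ∈ e, z ∈ N) := by
      intro e he
      rcases Finset.mem_union.1 (Finset.mem_coe.1 he) with heJ | heI
      · exact Or.inl ⟨heJ, hJ e heJ⟩
      · exact Or.inr (hIin e heI).1
    rcases detour_b_touched N {w₁, w₂} J _ hO u u' hu hu' h with rfl | ⟨⟨huW, hut⟩, ⟨hu'W, hu't⟩⟩
    · exact SimpleGraph.Reachable.refl _
    · by_cases huu : u = u'
      · rw [huu]
      · simp only [Finset.mem_insert, Finset.mem_singleton] at huW hu'W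
        have hpair : s(u, u') = s(w₁, w₂) ∧ ((∃ v ∈ N, s(v, w₁) ∈ J) ∧ (∃ v ∈ N, s(v, w₂) ∈ J)) := by
          rcases huW with rfl | rfl <;> rcases hu'W with rfl | rfl
          · exact (huu rfl).elim
          · exact ⟨rfl, hut, hu't⟩
          · exact ⟨Sym2.eq_swap, hu't, hut⟩
          · exact (huu rfl).elim
        rcases hQ with ⟨-, rfl⟩ | ⟨hnot, rfl⟩
        · exact ((openGraph_adj _ u u').2 ⟨by rw [hpair.1]; exact Set.mem_singleton _, huu⟩).reachable
        · exact (hnot hpair.2).elim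
  · intro e he
    have heF : e ∉ (↑F : Set (Sym2 (Fin n))) := by
      intro heF
      rcases Finset.mem_union.1 (Finset.mem_coe.1 heF) with h | h
      · obtain ⟨v, hv, rfl⟩ := Finset.mem_image.1 h
        exact he v (Sym2.mem_mk_left v w₁) hv
      · obtain ⟨v, hv, rfl⟩ := Finset.mem_image.1 h
        exact he v (Sym2.mem_mk_left v w₂) hv
    rw [pinW_apply_of_not_mem g _ heF]
    have h1 : ¬ ((∀ z ∈ e, z ∈ N) ∧ ¬ e.IsDiag) := by
      induction e using Sym2.ind with
      | h x x' => exact fun h => he x (Sym2.mem_mk_left x x') (h.1 x (Sym2.mem_mk_left x x'))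
    have h2 : ¬ (∃ z ∈ e, z ∈ N) := fun ⟨z, hz, hzN⟩ => he z hz hzN
    simp only [hg, h1, h2, if_false]

/-- **The glued block reaches `b` exactly when a touched relay does.**  `g = K/N`, `J ⊆ F` touching the relay `w` (some `s(v₁, w) ∈ J`, `v₁ ∈ N`):
`μ_{pinW g F J}(⋃_{v∈N} {v ↔ b}) = μ_{pinW g F J}(w ↔ b)` — almost surely the pairs of `J` and the pairs inside `N` are open. [folklore] -/
theorem real_blockReach_pinW_glued (hw₁ : w₁ ∉ N) (hw₂ : w₂ ∉ N)
    (J : Finset (Sym2 (Fin n))) (hJF : J ⊆ N.image (fun v => s(v, w₁)) ∪ N.image (fun v => s(v, w₂)))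
    {w v₁ : Fin n} (hv₁ : v₁ ∈ N) (hwN : w ∉ N) (hv₁J : s(v₁, w) ∈ J) :
    (prodBernoulli (pinW (fun e' : Sym2 (Fin n) => if (∀ z ∈ e', z ∈ N) ∧ ¬ e'.IsDiag then 1 else K e')
        (↑(N.image (fun v => s(v, w₁)) ∪ N.image (fun v => s(v, w₂))) : Set (Sym2 (Fin n))) ↑J)).real (⋃ v ∈ N, openConn v b) =
      (prodBernoulli (pinW (fun e' : Sym2 (Fin n) => if (∀ z ∈ e', z ∈ N) ∧ ¬ e'.IsDiag then 1 else K e')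
        (↑(N.image (fun v => s(v, w₁)) ∪ N.image (fun v => s(v, w₂))) : Set (Sym2 (Fin n))) ↑J)).real (openConn w b) := by
  set F : Finset (Sym2 (Fin n)) := N.image (fun v => s(v, w₁)) ∪ N.image (fun v => s(v, w₂)) with hFdef
  set g : Sym2 (Fin n) → unitInterval := fun e' => if (∀ z ∈ e', z ∈ N) ∧ ¬ e'.IsDiag then 1 else K e' with hg
  set p : Sym2 (Fin n) → unitInterval := pinW g (↑F : Set (Sym2 (Fin n))) ↑J with hp
  set I : Finset (Sym2 (Fin n)) := ((N ×ˢ N).filter (fun vv : Fin n × Fin n => vv.1 ≠ vv.2)).image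
    (fun vv => s(vv.1, vv.2)) with hI
  -- a.s. the contact pair `s(v₁, w)` and all internal pairs are open
  have hJopen : ∀ᵐ ω ∂(prodBernoulli p), s(v₁, w) ∈ ω :=
    prodBernoulli_ae_mem_of_eq_one p (pinW_apply_of_mem_of_mem g (Finset.mem_coe.2 (hJF hv₁J)) (Finset.mem_coe.2 hv₁J))
  have hIopen : ∀ᵐ ω ∂(prodBernoulli p), ∀ e ∈ I, e ∈ ω := by
    refine (Filter.eventually_all_finset I).2 fun e he => prodBernoulli_ae_mem_of_eq_one p ?_
    obtain ⟨⟨v, v'⟩, hvv, rfl⟩ := Finset.mem_image.1 he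
    obtain ⟨hvv', hne⟩ := Finset.mem_filter.1 hvv
    obtain ⟨hv, hv'⟩ := Finset.mem_product.1 hvv'
    have hin : (∀ z ∈ s(v, v'), z ∈ N) ∧ ¬ (s(v, v')).IsDiag := by
      refine ⟨fun z hz => ?_, fun h => hne (Sym2.mk_isDiag_iff.1 h)⟩
      rcases Sym2.mem_iff.1 hz with rfl | rfl
      · exact hv
      · exact hv'
    have hnotF : s(v, v') ∉ (↑F : Set (Sym2 (Fin n))) := by
      intro heF
      rcases Finset.mem_union.1 (Finset.mem_coe.1 heF) with h | h
      · obtain ⟨u, -, he⟩ := Finset.mem_image.1 h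
        exact hw₁ (hin.1 w₁ (by rw [← he]; exact Sym2.mem_mk_right u w₁))
      · obtain ⟨u, -, he⟩ := Finset.mem_image.1 h
        exact hw₂ (hin.1 w₂ (by rw [← he]; exact Sym2.mem_mk_right u w₂))
    rw [hp, pinW_apply_of_not_mem g _ hnotF]
    show (if (∀ z ∈ s(v, v'), z ∈ N) ∧ ¬ (s(v, v')).IsDiag then (1 : unitInterval) else K s(v, v')) = 1
    rw [if_pos hin]
  have hae : (⋃ v ∈ N, openConn v b : Set (BondConfig (Fin n))) =ᵐ[prodBernoulli p] (openConn w b : Set (BondConfig (Fin n))) := by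
    filter_upwards [hJopen, hIopen] with ω hωJ hωI
    -- every block vertex is joined to `w`
    have hvw : ∀ v ∈ N, (openGraph ω).Reachable v w := by
      intro v hv
      have hv1 : (openGraph ω).Reachable v v₁ := by
        by_cases hvv : v = v₁
        · rw [hvv]
        · exact ((openGraph_adj ω v v₁).2 ⟨hωI _ (Finset.mem_image.2 ⟨(v, v₁),
            Finset.mem_filter.2 ⟨Finset.mem_product.2 ⟨hv, hv₁⟩, hvv⟩, rfl⟩), hvv⟩).reachable
      exact hv1.trans ((openGraph_adj ω v₁ w).2 ⟨hωJ, fun h => hwN (h ▸ hv₁)⟩).reachable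
    refine propext ?_
    change ω ∈ (⋃ v ∈ N, (openConn v b : Set (BondConfig (Fin n)))) ↔ ω ∈ (openConn w b : Set (BondConfig (Fin n)))
    simp only [Set.mem_iUnion, exists_prop]
    constructor
    · rintro ⟨v, hv, hvb⟩
      exact (hvw v hv).symm.trans hvb
    · intro hwb
      exact ⟨v₁, hv₁, (hvw v₁ hv₁).trans hwb⟩
  exact measureReal_congr hae

/-- In `(ω ∖ pairs at N) ∪ {s(w₁,w₂)}` the two relays are interchangeable: `A_{12}(w₁) = A_{12}(w₂)`. [folklore] -/
theorem bridgeEvent_eq_of_swap (q : Sym2 (Fin n) → unitInterval) (h12 : w₁ ≠ w₂) :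
    (prodBernoulli q).real {ω : BondConfig (Fin n) | (openGraph (({e | e ∈ ω ∧ ∀ z ∈ e, z ∉ N} ∪ {s(w₁, w₂)} : Set (Sym2 (Fin n))) :
        BondConfig (Fin n))).Reachable w₁ b} =
      (prodBernoulli q).real {ω : BondConfig (Fin n) | (openGraph (({e | e ∈ ω ∧ ∀ z ∈ e, z ∉ N} ∪ {s(w₁, w₂)} : Set (Sym2 (Fin n))) :
        BondConfig (Fin n))).Reachable w₂ b} := by
  congr 1
  ext ω
  simp only [Set.mem_setOf_eq]
  have hadj : (openGraph (({e | e ∈ ω ∧ ∀ z ∈ e, z ∉ N} ∪ {s(w₁, w₂)} : Set (Sym2 (Fin n))) : BondConfig (Fin n))).Reachable w₁ w₂ :=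
    ((openGraph_adj _ w₁ w₂).2 ⟨Or.inr (Set.mem_singleton _), h12⟩).reachable
  exact ⟨fun h => hadj.symm.trans h, fun h => hadj.trans h⟩

end TwoRelaysGlued

end FingerBridgeGlued

end

end Summit.CriticalPhenomena.PercolationContinuityZ3.Theorems
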